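import Literature.Analysis.FluidPDE.OkamotoSakajoWunsch2008.SeparableBlowup
import Literature.Analysis.FluidPDE.OkamotoSakajoWunsch2008.CertificateP3
import HarnessLib

/-!
# OSW self-similar mechanism, companion module (MECHANISM.md §§29–34: THEOREMS M32–M39) — part 01 of 09

1-D model (gCLM/OSW), computer-assisted; not Euler/NS.  Filed under `Summits/NavierStokesRegularity/OSWSelfSimilar/` by a prover-role courier on behalf of the
mechanism seat pub-oswblow-mech (planner-pub-oswblow-mech-g29-0), cell pub-oswblow (host summit NavierStokesRegularity); the gate admits the path but
not role planner.  CONTENT = the staged transcript `pub-oswblow-mech/lean/OSWMechanismGlobalBranch.lean` (sha256 4e5de3f87ec94598…,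
2998 lines), source lines 200–379, UNCHANGED except: (i) namespace prefix `OSWSelfSimilar.Mechanism` → `Summit.NavierStokesRegularity.OSWSelfSimilar.Mechanism`;
(ii) [parts >= 02 only: the frames open at the cut are re-opened above the body and closed at the end; nothing to re-open here]
(iii) this docstring and, below it, the transcript's own module documentation VERBATIM (renamed).  Generated by `pub-oswblow-mech/lean/courier/make_split.py`; the parts must be filed IN ORDER
(each imports its predecessor).  First/last declarations here: `fR` … `strain_of_rung` (18 in this part).
AI-written transcript; kernel-checked on the farm as ONE file before splitting (see the kit's CHECKS); to be checked, not trusted.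
-/

/-!
# OSW self-similar mechanism — companion module, v28: sections `GlobalBranch` (MECHANISM.md §29, THEOREM M32; v23),
# `ChordSlope` (MECHANISM.md §30, THEOREM M33; v24), `SourceDefect` (MECHANISM.md §31, THEOREMS M34, M35; v25),
# `FirstCritFloor` (MECHANISM.md §32, THEOREM M36; v26), `EffectiveFloor` (MECHANISM.md §33, THEOREMS M37, M38; v27)
# and `ChenArcShape` (MECHANISM.md §34, THEOREM M39, COROLLARY 34.5; v28)

1-D model (gCLM/OSW), computer-assisted; not Euler/NS.

gen 24, planner-pub-oswblow-mech-g24-0, 2026-08-20; v1.1 track.  Source of truth for the mathematics: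
`pub-oswblow-mech/MECHANISM.md` (v23), §29.  Built by `compute/v23/build_companion_v23.py` from
`compute/v23/lean/Scratch29.lean` (Mathlib-only part, rc 0 stand-alone) and `compute/v23/lean/v23_typed.lean.txt`.

WHY A COMPANION MODULE.  `lean/OSWMechanism.lean` (v22, 8958 lines, 519 096 bytes, sha256 9c32c87e…, rc 0) is within
5 KB of the Lean farm's single-file limit (512 KiB); the v23 material (≈ 28 KB) therefore lives in THIS stand-alone file,
which imports the same landed vocabulary (`fourierEval`, `hilbertCoeff`, `velocityEval`, `IsRealSeq`, `IsOddSeq`) and is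
checked on its own (`lean check`: rc 0, 0 sorries, axioms `propext`, `Classical.choice`, `Quot.sound` —
`lean/OSWMechanismGlobalBranch.v23.check.json`).  `lean/OSWMechanism.lean` is UNCHANGED by v23 (= the pin
`OSWMechanism.v22.lean`).  Two stand-alone files cannot import one another outside the project tree, so the typed
statements below are PARAMETRIC in the profile hypothesis `NegP : ℝ → (ℤ → ℂ) → Prop`; the intended instantiation is
`NegP := Summit.NavierStokesRegularity.OSWSelfSimilar.Mechanism.NegProfileHyp` of `OSWMechanism.lean` (negative class-(H) profile of (T1) with
parameter `a`), and `MechanismStatementV23 := MechanismStatementV22 ∧ GlobalBranchBundle NegProfileHyp` is the one-line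
bundle to be added when the operator places both files in one import graph.  The three one-line real-valued evaluations
`fR`, `HfR`, `gR` are restated VERBATIM from `OSWMechanism.lean` ll. 162–166 (they agree by `rfl`); nothing else is
duplicated.  The kernel-checked REDUCTIONS (`BranchFamily.ladder`, `.rung`, …) hold for every `NegP`.

CONTENT.  THE NEGATIVE BRANCH IS GLOBAL (THEOREM M32).  In the variables `(ε, v) = (1−a, (1−a)f)` the profile equation
with the normalisation `q₀ = 1` is a real-analytic map `𝒢 : ℝ × X^{0,β} → Y^{0,β} × ℝ` whose `v`-derivative is Fredholm
of INDEX 0 at EVERY negative simple-source profile (LEMMA 29.2: `L^{loc}` index +1 on `X^{0,β}` for arbitrary real sink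
exponent `p > 1`, `K : X^{0,β} → C^{0,1}` compact, the functional `Hφ(0)` lowers the index to 0); the De Gregorio
equilibrium `(0, −sin x)` is a REGULAR point on `∂U` (LEMMA 29.5, `(−𝓛; ev₀H)` an isomorphism, Prop. 23.1), Chen's
family the implicit-function branch there; Hölder-bounded sets of profiles with `a ⋐ (3/5,1)` are precompact with
Lipschitz bounds on `f`, `sin x·f′` (LEMMA 29.4), the sink being kept non-degenerate by PROPOSITION 29.3
(`B₀ ≥ (A₀/8)(πβA₀/(4N_β))^{2/β}` — no equation); hence Buffoni–Toland's analytic continuation of distinguished arcs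
[BT03, Thm 9.1.1 and its proof, Steps 1–4 — cited by the book's own numbering; the ingested copy is machine-chunked, see MECHANISM.md §29.0] yields a continuous, locally analytic, never-looping curve `𝔎` of negative simple-source
profiles from `a = 1` which ends only by Hölder blow-up of `(1−a)f` on a compact sub-window (forced when `p → ∞`), by
return to `a = 1` as a second family, or at `a = 3/5` (THEOREM 29.6 = M32); COROLLARY 29.7: `p → ∞ ⇒` Hölder
blow-up (PROVED) and — CONDITIONAL on `sup_𝔎 p = ∞` — EVERY RUNG OF THE LADDER LIES ON `𝔎`; QUESTION 29.8 (the
missing a-priori Hölder bound at bounded sink exponent).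

KERNEL-CHECKED here (the Mathlib-only part also checked stand-alone as `compute/v23/lean/Scratch29.lean`): the
trigonometry of (29.2) (`1 − cos(x±y) = (1 − cos x cos y) ± sin x sin y`, `(D+S)/(D−S) ≥ 1 + S`, `log(1+t) ≥ t log 2` on
`[0,1]` from the concavity of `log`, and the assembled `kernel_lower_bound`); `cot(x/2) ≤ 2/x`, `δ/2 ≤ tan(δ/2)`,
`cos(y/2) ≥ sin(η/2)` on `[0, π−η]`, `η/π ≤ sin(η/2)`; the algebra (29.4) ⇒ (29.5) and (29.6); the window algebra
`1 + 1/B₀ < p < (5/3)(1 + 1/B₀)`, `p ≤ p♯ ⇒ B₀ ≥ 1/(p♯a − 1)`, and the rung form `p = P ⇒ Hf(π) = −1/(Pa − 1)`; the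
no-loop spine of Step 3 (a set inside `U` misses `z₀ ∉ U`; `z₀ ∈ cl 𝒜₀` from `γ(σ) → z₀`; a frontier point of an
open set is outside it); the intermediate-value step of COROLLARY 29.7 (iii) (`ladder_of_unbounded`, from Mathlib's
`intermediate_value_Icc`); and, over the typed BRANCH FAMILY, `continuousOn_p`, `ladder`, `rung`,
`sink_lower_of_bounded`, `sink_degenerates_of_conjecture`, `ladderOnBranch_of_v23`.
TYPED ONLY (Props, no axiom, no sorry; proved pen-and-paper in MECHANISM.md §29): `KernelLowerStatement` (Lemma
29.1(b)), `SinkNondegStatement` (Prop. 29.3(a)), `GlobalBranchStatement` (THEOREM M32 — its typed SHADOW: what a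
coefficient-sequence type can say of a Banach-manifold statement is listed in `BranchFamily`'s docstring);
`HolderAprioriConjecture` (QUESTION 29.8(a)) is typed OPEN.  NOT formalised: Hölder/transport spaces, Privalov,
Fredholm theory, LEMMAS 29.2, 29.4, 29.5 and [BT03] itself.

## v24 (gen 25, planner-pub-oswblow-mech-g25-0, 2026-08-20; v1.1 track): namespace `Summit.NavierStokesRegularity.OSWSelfSimilar.Mechanism.ChordSlope`
(MECHANISM.md v24 §30, THEOREM M33).  Built by `compute/v24/build_companion_v24.py` from `compute/v24/lean/Scratch30.lean`
(Mathlib-only, rc 0 stand-alone) and `compute/v24/lean/v24_typed.lean.txt`; the v23 text above and below is byte-identical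
to the pin `OSWMechanismGlobalBranch.v23.lean` apart from this paragraph and the inserted namespace.
§30 in one sentence: QUESTION 29.8 is a question about ONE number, the chord slope `N₁ = sup F/sin x` (LEMMA 30.1: the
Hölder seminorm of a negative simple-source profile is bounded by `N₁` alone); the three alternatives (E1)/(E2)/(E3) of
THEOREM M32 are ONE alternative — the blown-down chord slope `𝔰 = (1−a)N₁ → ∞` along `𝔎` (THEOREM M33, via RIGIDITY AT
THE DE GREGORIO POINT, THEOREM 30.3); hence the ladder on `𝔎` follows from ANY a-priori bound `𝔰 ≤ Ψ(|Hf(π)|)`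
(COROLLARY 30.6), and (29.10) HOLDS in `𝒮_LC` (THEOREM 30.7).
KERNEL-CHECKED here: `sin y cot(y/2) = 1 + cos y`, `sin y tan(y/2) = 1 − cos y`, `∫₀^π (1 + cos) = π`; the algebra of
(30.2) (`l2_lower_alg`), of `c_G` (`cG_alg`), of LEMMA 30.1 (b) (`fprime_pointwise_alg`), the sup-from-a-zero step
(`sup_le_of_vanish_holder`), Jordan's `x ≤ (π/2) sin x`; LEMMA 30.4: the optimisation `B₀ ≤ (4/π)(MN₁)^{1/2}`
(`sink_upper_opt`), the weight `w = sin x (π/2 − tan(x/2))` with `∫₀^π w = 0` and the Chebyshev step for antitone `u`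
(`weight_factor`, `weight_integral_zero`, `antitone_weight_pointwise`), the window discriminant and `B₀ < (π/2)√D`,
`(8√2/(5π))² = 128/(25π²)`; THEOREM 30.3 Step 3 (`single_mode_of_proportional`, `mode_one_of_one_signed`); the M33 spine
(`eventually_of_three_regimes`, `diverges_of_three_regimes`) and its `a → 3/5` contradiction (`l2_sandwich_contra`); the
algebra of COROLLARY 30.6 (c) (`layer_degenerates_alg`) and of THEOREM 30.7 (`slope_bound_LC_alg`); the exact source
rescaling (30.9) (`inner_rescaling_identity`); and, over the typed BRANCH FAMILY of v23: THEOREM M33 on compact windows from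
`escape` + LEMMA 30.1 (c) (`BranchFamily.noBoundedSlope_on_window`), M33 from its regime exclusions
(`BranchFamily.chordSlopeDiverges`, `chordSlopeDivergence_of`), COROLLARY 30.6 (a) (`sink_to_zero`, `p_unbounded`,
`ladder_of_slope_bound`, `ladder_of_slope_apriori`, `ladder_of_v24`) and COROLLARY 30.6 (b) (`ladder_in_LC`).
TYPED ONLY (Props, no axiom, no sorry; proved pen-and-paper in MECHANISM.md §30 unless marked open):
`HolderFromChordStatement` (LEMMA 30.1 (c)), `RigidityAtDGStatement` (THEOREM 30.3), `NoBoundedReturn` /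
`NoBoundedCollapse` / `GlobalBranchV24Statement` (the two regime exclusions attached to M32's curve),
`ChordSlopeDivergenceStatement` (THEOREM M33's shadow), `SlopeBoundLCStatement` (THEOREM 30.7), `InSLC` (the class
`𝒮_LC` on `u = F/sin x`); `SlopeAprioriConjecture` (QUESTION 30.10 (a)) is typed OPEN.  NOT formalised: LEMMA 30.1's
analysis (Parseval/Privalov/Morrey on `𝕋`), THEOREM 30.3 Steps 1, 2, 4, PROPOSITION 30.9 (Fourier support on `𝒮′(ℝ)`).

## v25 (gen 26, planner-pub-oswblow-mech-g26-0, 2026-08-20; v1.1 track): namespace `Summit.NavierStokesRegularity.OSWSelfSimilar.Mechanism.SourceDefect`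
(MECHANISM.md v25 §31, THEOREMS M34, M35).  Built by `compute/v25/build_companion_v25.py` from `compute/v25/lean/Scratch31.lean`
(Mathlib-only, rc 0 stand-alone) and `compute/v25/lean/v25_typed.lean.txt`; the v24 text above and below is byte-identical
to the pin `OSWMechanismGlobalBranch.v24.lean` apart from this paragraph, the title line and the inserted namespace.
§31 in one sentence: the SOURCE DEFECT FORMULA `F = |f′(0)|·x·(g/(A₀x))^{1/a}·exp(−(1/(aA₀))∫₀ˣ ε/((1−ε)s))` ([HQWW23, §2] on
`𝕋`; LEMMA 31.1) and two one-sided bounds of the strain deficit `A₀ − Hf` by the excess area of `u = F/sin x` (LEMMA 31.2)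
give NO NEEDLE in the whole monotone class `𝒮` — the chord slope is at most `T(a) = π·e^{48.04/a}` times `F(x_m)/x_m` at the
FIRST critical point (THEOREM M34) —, hence (29.10) in the SINGLE-CROSSING class `𝒮₁ ⊃ 𝒮_LC` (THEOREM M35) and the
conclusions of §30 with `𝒮_LC` replaced by `𝒮₁` (COROLLARY 31.5); the residual scenario in `𝒮` is an early first bump
followed by a cliff (REMARK 31.6, QUESTION 31.7).
KERNEL-CHECKED here: the algebra of (31.1)/(31.2) (`defect_exponent`, `A0_sub_one`, `localExponent_eq`,
`one_sub_localExponent`, `deficit_identity`); `−log(1−ε) ≤ ε/(1−ε) ≤ 2ε` and `1/(1−ε) ≤ 2` on `[0,½]`; the cosine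
inequalities of LEMMA 31.2 (`cos_sub_cos_ge_jordan`: `cos s − cos t ≥ (2/π²)(t²−s²)` on `0 ≤ s ≤ t ≤ π/2`;
`cos_sub_cos_le_half_sq_sub`; `one_sub_cos_ge`; `inv_cos_pi_div_four`) and its numerical constant
(`tu_coefficient_lt_six`: `π(19/12 + (1+√2)/8) < 6`); the three steps of THEOREM M34 as algebra (`half_retention_alg`,
`else_branch_alg`, `climb_alg`, `tm_bound`) and its constant (`T_le_exp`, `exponent_lt_fifty`, `noNeedleT_le`:
`T(a) ≤ e^{50/a}`); THEOREM M35's algebra (`sink_floor_alg`, `x0_sq_lt`, `location_alg`, `slope_bound_S1_alg`) and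
COROLLARY 31.5 (c) (`first_bump_runs_in_alg`); and, over the typed BRANCH FAMILY of v23: COROLLARY 31.5 (a)
(`BranchFamily.ladder_in_S1`), `slopeBoundLC_of_S1` (M35 ⊇ THEOREM 30.7 given LEMMA 28.2 (b)), the reduction of REMARK
31.6 (3)(α) (`slopeBoundS_of_noNeedle_floor`) and `ladder_of_v25`.
TYPED ONLY (Props, no axiom, no sorry; proved pen-and-paper in MECHANISM.md §31 unless marked open): `InS`, `InS1`,
`IsFirstCrit`, `NoNeedleStatement` (M34), `SlopeBoundS1Statement` (M35), `LCsubS1Statement` (LEMMA 28.2 (b)),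
`AmplitudeBoundStatement` ((22.9)); `FirstCritFloorConjecture` (QUESTION 31.7 (a)) and `SlopeBoundSStatement` ((29.10) in
`𝒮`) are typed OPEN.  NOT formalised: LEMMA 31.1's integration of (T1) and LEMMA 31.2's integral estimates (Fubini/Hardy
steps), i.e. the analysis of §31.

## v26 (gen 27, planner-pub-oswblow-mech-g27-0, 2026-08-20; v1.1 track): namespace `Summit.NavierStokesRegularity.OSWSelfSimilar.Mechanism.FirstCritFloor`
(MECHANISM.md v26 §32, THEOREM M36).  Built by `compute/v26/build_companion_v26.py` from `compute/v26/lean/Scratch32.lean`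
(Mathlib-only, rc 0 stand-alone) and `compute/v26/lean/v26_typed.lean.txt`; the v25 text above and below is byte-identical
to the pin `OSWMechanismGlobalBranch.v25.lean` apart from this paragraph, the title line and the appended namespace.
§32 in one sentence: QUESTION 31.7 (a) is answered YES — the first critical point of a monotone profile cannot run into the
source on a window `a ≤ a₂ < 1`, `|Hf(π)| ≥ b > 0` (THEOREM M36, INEFFECTIVE, by compactness: a violating sequence has
`x_m → 0` with bump height `F(x_m) ≥ a/32` (LEMMA 32.3); its Helly limit is a monotone weak solution of (T1) whose strain obeys
NO OVERSHOOT `Hf_∞ ≤ A_body` (PROPOSITION 32.4); `A_body > 1` is excluded on the sequence by OCTAVE TRANSPORT under unspent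
budget (LEMMAS 32.1, 32.2), `A_body ≤ 1` by rigidity of the limit) — hence (29.10) in ALL of `𝒮` and the ladder along every
eventually-monotone branch with `limsup a < 1` (COROLLARY 32.6).  `FirstCritFloorConjecture` and `SlopeBoundSStatement` of the
v25 block, typed OPEN there, are thereby PROVED pen-and-paper; their v25 docstrings are superseded by `FirstCritFloorStatement`
below and left byte-identical.
KERNEL-CHECKED here: LEMMA 32.1's trigonometry and bookkeeping (`half_le_tan_half`, `x_mul_cos_half_le_two_sin_half`:
`x·cot(x/2) ≤ 2`; `kernel_slope_ge_cot_half`: `∂ₓΛ ≥ cot(y/2)`; `velocity_upper_alg`, `avg_strain_alg`); LEMMA 32.2's algebra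
(`octave_growth_alg`, `octave_loss_alg`, `cot_half_ge`: `cot(s/2) ≥ 1.8/s` on `(0,½]`, `heavy_count_alg`); LEMMA 32.3's
algebra and numerics (`u_slope_alg`, `G_slope_alg`, `one_sub_cos_eq`, `cos_half_sub_cos_eq`, `t1_ratio_le`, `bootstrap_unroll`,
`bootstrap_sum_le`: `Σ_j r^j(13.52 + 2.01j) ≤ 14.35`, `tangent_height_contra`, `Km_floor_alg`); PROPOSITION 32.4 (v)'s kernel
identity (`inv_cos_sub_cos`); THEOREM M36 STEP 3's octave count (`octave_count_alg`) and the floor ⇔ slope-bound algebra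
(`floor_of_slope_bound_alg`); and, over the typed BRANCH FAMILY of v23–v25: COROLLARY 32.6 (a) (`BranchFamily.ladder_in_S`),
`slopeBoundS1_of_S` (M36 ⊇ M35), `firstCritFloor_of_slopeBoundS` and `slopeBoundS_of_v26` (floor ⇔ (29.10) on `𝒮`),
`ladder_of_v26`.
TYPED ONLY (Props, no axiom, no sorry; PROVED pen-and-paper in MECHANISM.md §32): `TangentHeightStatement` (LEMMA 32.3),
`FirstCritFloorStatement` (:= `FirstCritFloorConjecture`; THEOREM M36), `FirstCritFloorBundle`.  NOT formalised: PROPOSITION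
32.4 (Helly, conjugate-function theory on `𝕋`, weak limits, the `W^{1,2}` product rule), the integral estimates of LEMMAS
32.1–32.3, the compactness proof of THEOREM M36.

## v27 (gen 28, planner-pub-oswblow-mech-g28-0, 2026-08-20; v1.1 track): namespace `Summit.NavierStokesRegularity.OSWSelfSimilar.Mechanism.EffectiveFloor`
(MECHANISM.md v27 §33, THEOREMS M37, M38).  Built by `compute/v27/build_companion_v27.py` from `compute/v27/lean/Scratch33.lean`
(Mathlib-only, rc 0 stand-alone) and `compute/v27/lean/v27_typed.lean.txt`; the v26 text above and below is byte-identical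
to the pin `OSWMechanismGlobalBranch.v26.lean` apart from this paragraph, the title line and the appended namespace.
§33 in one sentence: QUESTION 32.8 (b) is answered YES — the compactness proof of THEOREM M36 is replaced by a
QUANTITATIVE RIGIDITY estimate (THEOREM M37: if the unspent budget at scale `ε` is `R(ε) ≤ 1 + 1/L` with
`L ≥ 1 + (4/a)·log(π/(2ε))`, then beyond `X = 2^J·L·ε` the profile is flat, `F ≤ 13.3/J`, and the sink strain obeys
`|Hf(π)| ≤ 0.13·X²·Hf(0) + 14.4/J` — by a LIGHT OCTAVE (pigeonhole on the budget), transport on the body amplifying the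
light octave's height by at most `e`, and a FENCE at height `< π/4` beyond the half-budget point), which makes THEOREM M36
EFFECTIVE (THEOREM M38: an explicit, astronomically large `Ψ_𝒮^eff(a₂,b)`, `psiEff`; COROLLARY 33.7: the explicit floor
`ξ^eff`); and the monotonicity inequality `χ ≤ 0` defining `𝒮` is STRICT AT BOTH ENDPOINTS along the branch (LEMMA 33.8:
`u″(0) ≤ −C₀/(2a·Hf(0)) < 0`, `χ(π⁻) ≤ −1`), so `𝒮` can only be exited through an interior double zero of `u′` (QUESTION
32.8 (a) stays open; REMARK 33.9 records why no sign argument closes it).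
KERNEL-CHECKED here: THEOREM M37's algebra and numerics (`strain_beyond_alg`, `delta_prime_alg` (LEMMA 33.1);
`light_octave_exists`, `tan_le_on_quarter`: `tan x ≤ (32/31)x` on `(0,¼]`, `light_height_alg` (LEMMA 33.2);
`transport_integrand_le`, `exponent_alg`, `rpow_le_exp_one`, `body_height_alg`: `s₁ ≤ 13.3/J < π/4`, `tail_slope_neg`,
`fence` (LEMMA 33.3; the fence is Mathlib's `image_le_of_deriv_right_lt_deriv_boundary`); `sink_split_alg`, `M37_sink_alg`
(LEMMA 33.4)); THEOREM M38's two cases and its explicit data (`L_window_alg`, `epsL_le_Q`: `Q³(1 + (20/3)log(π/(2Q³))) ≤ Q`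
on `(0, 2⁻¹⁹]`, `effScale_le`: `2^{J_b}·L_b·ε_b ≤ X_b`, `effJ_ge`, `effJ_ge'`, `effX_sq_le`, `effQ_le`, `case1_alg`,
`case2_contra`; definitions `octaveCountBound`, `effJ`, `effX`, `effQ`, `effEps`, `effL`, `effTheta`, `psiEffOf`, `psiEff`,
`xiEff`); LEMMA 33.8's algebra (`source_curv_integrand`, `source_endpoint_strict`: `c₂ ≤ −1/2`, `sink_endpoint_strict`); and
the spines `slopeBoundS_of_effective` (M38 ⊇ M36), `effectiveFloor_of_effective` (COROLLARY 33.7), `floor_of_effectiveFloor`,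
`ladder_of_v27`.
TYPED ONLY (Props, no axiom, no sorry; PROVED pen-and-paper in MECHANISM.md §33): `EffectiveSlopeBoundSStatement` (THEOREM
M38), `EffectiveFirstCritFloorStatement` (COROLLARY 33.7), `EffectiveFloorBundle`.  NOT formalised: the integral estimates
((32.1), (32.2), LEMMA 33.4's split of `Hf(π)`), the transport law (T1) on the body as an ODE statement, THEOREM 32.5 STEP
3's octave count as an inequality between integrals, LEMMA 33.8's expansions at `0` and `π` — i.e. the analysis of §33.

## v28 (gen 29, planner-pub-oswblow-mech-g29-0, 2026-08-20; v1.1 track): namespace `Summit.NavierStokesRegularity.OSWSelfSimilar.Mechanism.ChenArcShape`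
(MECHANISM.md v28 §34, THEOREM M39, COROLLARY 34.5).  Built by `compute/v28/build_companion_v28.py` from
`compute/v28/lean/Scratch34.lean` (Mathlib-only, rc 0 stand-alone) and `compute/v28/lean/v28_typed.lean.txt`; the v27 text above
and below is byte-identical to the pin `OSWMechanismGlobalBranch.v27.lean` apart from this paragraph, the title line and the
appended namespace.
§34 in one sentence: the gap of THEOREM 23.5 (iii) ('membership in `𝒮` including the source layer `x ≲ ε` and the sink layer
is NOT obtained') is closed — a FUCHSIAN BOOTSTRAP at the regular-singular source (LEMMA 34.2: Proposition 3.6's integrating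
factor `V = 𝔰₀·x·e^Λ`, `V′ = 𝔰₀e^Λ(1+μ)`, gives UNIFORM `C^{k,β}` bounds at `0` for bounded families of negative simple-source
profiles and, RELATIVE to the De Gregorio profile, for Chen's analytic family incl. complex `1 − a`), Privalov's theorem in
pseudo-local quantitative form (LEMMA 34.1) and the explicit limiting defect `χ⁰ = −sin x·ψ′ ≤ −sin²(x/2) − x sin x/2`
((34.2′), from LEMMA 23.4) show that the transport defect `χ_ε = Hf_ε − 1 − a g_ε cot x` converges to `χ⁰` UNIFORMLY ON
`(0,π)` with rate `O(ε)` and in `C^k` off the sink (LEMMA 34.3); hence (THEOREM M39) Chen's arc `1 − ε_𝒮 ≤ a < 1` satisfies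
`χ ≤ −½ sin²(x/2)` on all of `(0,π)`, `u = F/sin x` is STRICTLY decreasing with the rate `−u′ ≥ u tan(x/2)/(6aA₀)`, the
profiles lie in `𝒮₁ ⊂ 𝒮` (every theorem of §§22–33 on `𝒮` applies to them; the negative branch `𝔎` STARTS INSIDE `𝒮`),
and the blown-down chord slope is the convergent power series `𝔰(ε) = 1 − ε d(ε) = 1 + (2 log 2 − ½)ε + O(ε²)` (REMARK (2)
to THEOREM 30.3 answered: `𝔰 → 1⁺`); and (COROLLARY 34.5) the defect is continuous along `𝔎` in `C⁰([0,π])`, so LEMMA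
33.8's exit statement holds WITHOUT its `C³`-continuity hypothesis and the EXIT PARAMETER `σ_𝒮 = sup{σ : f((0,σ]) ⊂ 𝒮}`
obeys a dichotomy: `σ_𝒮 = ∞` (the whole branch in `𝒮`: ladder or `(E2♯)`, COROLLARY 32.6 (b)) or `f(σ_𝒮) ∈ 𝒮 ∩ 𝔎` has
an interior double zero of `u′` (QUESTION 34.7 (a) = 33.10 (a) localised to single profiles).
KERNEL-CHECKED here: `chi0_identity` ((34.2)), `half_sin_mul_tan_half`, `chi0_le_of_psi_deriv_lb` ((34.2′)),
`mul_cos_le_sin`, `sub_mul_abs_cos_le_sin` (`min(x,π−x)|cot x| ≤ 1`, LEMMA 34.3 (i)), `deriv_bound_of_second`,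
`c2_taylor_bound` (the even-`C²` Taylor bound at the source), `source_margin` (Jordan's inequality, `η ≤ 2/π`),
`bulk_sink_margin` (`δ ≤ ½ sin²(½)`), `chen_arc_envelope` (M39 (a)'s envelope from its analytic inputs), `neg_u_deriv_lb`
(`−u′ ≥ u tan(x/2)/(6aA₀)`), `d0_neg`, `frak_s_gt_one` (M39 (b): `𝔰 > 1`), `exit_parameter_dichotomy` (COROLLARY 34.5 (c),
order-theoretic skeleton); and, over the typed branch family: `start_in_S`, `chordSlope_tendsto_one`,
`chordSlope_gt_one_eventually`, `shapeSet_relClosed` (`𝒯` relatively closed from COROLLARY 34.5 (a) + (22.16)),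
`exit_dichotomy`, `shape_of_v28`.
TYPED ONLY (Props, no axiom, no sorry; PROVED pen-and-paper in MECHANISM.md §34): `DefectCharacterisesS` ((22.16)),
`DefectContinuous` (COROLLARY 34.5 (a)), `ArcStrictlyInS` (THEOREM M39 (a)), `ChordSlopeExpansion` (THEOREM M39 (b)),
`ChenArcShapeStatement`, `ChenArcShapeBundle`.  NOT formalised: LEMMA 34.1 (Privalov, pseudo-local), LEMMA 34.2 (the
Fuchsian bootstrap in `C^{k,β}`; holomorphy in `ε`), LEMMA 34.3 (the rate `C₁ε`), the `𝒮₁` count, COROLLARY 34.5 (b)'s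
touching argument — i.e. the analysis of §34, which lives in M28's spaces `W`, `X^{0,β}` outside this module's vocabulary.
-/

noncomputable section

open Complex Set Filter
open scoped Topology
open Literature.Analysis.FluidPDE.OkamotoSakajoWunsch2008

namespace Summit.NavierStokesRegularity.OSWSelfSimilar.Mechanism.GlobalBranch

/-! ### Real-valued profile, conjugate function and velocity (verbatim from `OSWMechanism.lean`, ll. 162–166) -/

/-- The profile `f` as a real function of `x : ℝ` (real part of the Fourier series). -/
def fR (c : ℤ → ℂ) (x : ℝ) : ℝ := (fourierEval c x).re
/-- The conjugate function `Hf` (multiplier `-i sgn k`). -/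
def HfR (c : ℤ → ℂ) (x : ℝ) : ℝ := (fourierEval (hilbertCoeff c) x).re
/-- `g = ∫₀ˣ Hf` (mean-zero primitive of `Hf`; OSW's velocity). -/
def gR (c : ℤ → ℂ) (x : ℝ) : ℝ := (velocityEval c x).re

/-! ### (29.2): `Λ(x,y) ≥ ½ log(1 + sin x sin y) ≥ (log 2 / 2) sin x sin y` -/

/-- `1 − cos(x+y) = (1 − cos x cos y) + sin x sin y` and `1 − cos(x−y) = (1 − cos x cos y) − sin x sin y`. -/
theorem kernel_ratio_identity (x y : ℝ) :
    1 - Real.cos (x + y) = (1 - Real.cos x * Real.cos y) + Real.sin x * Real.sin y ∧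
    1 - Real.cos (x - y) = (1 - Real.cos x * Real.cos y) - Real.sin x * Real.sin y := by
  constructor
  · rw [Real.cos_add]; ring
  · rw [Real.cos_sub]; ring

/-- With `D = 1 − cos x cos y`, `S = sin x sin y`: `0 < D − S ≤ 2`, `0 ≤ S` ⇒ `1 + S ≤ (D+S)/(D−S)`. -/
theorem kernel_ratio_ge (D S : ℝ) (h1 : 0 < D - S) (h2 : D - S ≤ 2) (hS : 0 ≤ S) :
    1 + S ≤ (D + S) / (D - S) := by
  rw [le_div_iff₀ h1]
  nlinarith [mul_le_mul_of_nonneg_left h2 hS]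

/-- Concavity of `log`: for `0 ≤ t ≤ 1`, `t · log 2 ≤ log (1 + t)`. -/
theorem log_one_add_ge_mul_log_two (t : ℝ) (h0 : 0 ≤ t) (h1 : t ≤ 1) :
    t * Real.log 2 ≤ Real.log (1 + t) := by
  have hc := (strictConcaveOn_log_Ioi).concaveOn
  have key := hc.2 (show (1:ℝ) ∈ Set.Ioi 0 by norm_num) (show (2:ℝ) ∈ Set.Ioi 0 by norm_num)
    (show 0 ≤ 1 - t by linarith) h0 (show (1 - t) + t = 1 by ring)
  simp only [smul_eq_mul, Real.log_one, mul_zero, zero_add, mul_one] at key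
  have h2 : (1 - t) + t * 2 = 1 + t := by ring
  rw [h2] at key
  exact key

/-- **(29.2) kernel-checked in trigonometric form:** if `0 < sin x sin y ≤ 1` and `0 < 1 − cos(x−y) ≤ 2`, then
`(log 2 / 2) · sin x sin y ≤ ½ · log((1 − cos(x+y))/(1 − cos(x−y)))` (`= Λ(x,y)`, since
`sin²((x±y)/2) = (1 − cos(x±y))/2`). -/
theorem kernel_lower_bound (x y : ℝ) (hS0 : 0 < Real.sin x * Real.sin y) (hS1 : Real.sin x * Real.sin y ≤ 1)
    (hD0 : 0 < 1 - Real.cos (x - y)) (hD2 : 1 - Real.cos (x - y) ≤ 2) :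
    Real.log 2 / 2 * (Real.sin x * Real.sin y) ≤
      1 / 2 * Real.log ((1 - Real.cos (x + y)) / (1 - Real.cos (x - y))) := by
  obtain ⟨hp, hm⟩ := kernel_ratio_identity x y
  set D := 1 - Real.cos x * Real.cos y with hD
  set S := Real.sin x * Real.sin y with hS
  have h1 : 0 < D - S := by rw [← hm]; exact hD0
  have h2 : D - S ≤ 2 := by rw [← hm]; exact hD2
  have hr : 1 + S ≤ (D + S) / (D - S) := kernel_ratio_ge D S h1 h2 hS0.le
  have hlog1 : S * Real.log 2 ≤ Real.log (1 + S) := log_one_add_ge_mul_log_two S hS0.le hS1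
  have hlog2 : Real.log (1 + S) ≤ Real.log ((D + S) / (D - S)) :=
    Real.log_le_log (by linarith) hr
  rw [hp, hm]
  linarith

/-! ### Elementary inequalities for PROPOSITION 29.3 -/

/-- `cot(x/2) ≤ 2/x` on `(0,π)` (from `t < tan t` on `(0,π/2)`). -/
theorem cot_half_le_two_div (x : ℝ) (h0 : 0 < x) (hπ : x < Real.pi) :
    1 / Real.tan (x / 2) ≤ 2 / x := by
  have h1 : 0 < x / 2 := by linarith
  have h2 : x / 2 < Real.pi / 2 := by linarith
  have ht : x / 2 < Real.tan (x / 2) := Real.lt_tan h1 h2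
  have h3 : 1 / Real.tan (x / 2) ≤ 1 / (x / 2) := one_div_le_one_div_of_le h1 ht.le
  have h4 : 1 / (x / 2) = 2 / x := by field_simp
  linarith [h4 ▸ h3]

/-- `δ/2 ≤ tan(δ/2)` and `(δ/2)² ≤ tan²(δ/2)` on `(0,π)`. -/
theorem tan_half_ge_half (δ : ℝ) (h0 : 0 < δ) (hπ : δ < Real.pi) :
    δ / 2 ≤ Real.tan (δ / 2) ∧ (δ / 2) ^ 2 ≤ Real.tan (δ / 2) ^ 2 := by
  have h1 : 0 < δ / 2 := by linarith
  have h2 : δ / 2 < Real.pi / 2 := by linarith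
  have ht : δ / 2 ≤ Real.tan (δ / 2) := (Real.lt_tan h1 h2).le
  exact ⟨ht, pow_le_pow_left₀ h1.le ht 2⟩

/-- On `(0, π − η]` with `0 < η`: `cos(y/2) ≥ sin(η/2)`, the step behind `tan(y/2) ≤ sin y/(2 sin²(η/2))`. -/
theorem cos_half_ge_sin_half (y η : ℝ) (hy0 : 0 ≤ y) (hη : 0 < η) (hyη : y ≤ Real.pi - η) :
    Real.sin (η / 2) ≤ Real.cos (y / 2) := by
  have h1 : Real.sin (η / 2) = Real.cos (Real.pi / 2 - η / 2) := by rw [Real.cos_pi_div_two_sub]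
  rw [h1]
  apply Real.cos_le_cos_of_nonneg_of_le_pi <;> linarith

/-! ### The algebra of PROPOSITION 29.3 -/

/-- (29.4) ⇒ the sink lower bound: `πA₀ ≤ T + c·πB₀`, `T ≤ πA₀/2`, `c > 0` ⇒ `A₀/(2c) ≤ B₀`. -/
theorem sink_split_bound (A0 B0 T c : ℝ) (h : Real.pi * A0 ≤ T + c * (Real.pi * B0))
    (hT : T ≤ Real.pi * A0 / 2) (hc : 0 < c) : A0 / (2 * c) ≤ B0 := by
  have hπ := Real.pi_pos
  have h1 : Real.pi * A0 / 2 ≤ c * (Real.pi * B0) := by linarith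
  rw [div_le_iff₀ (by positivity)]
  nlinarith

/-- With `c = 1/tan²(δ/2)`: `A₀/(2c) = A₀ tan²(δ/2)/2`. -/
theorem half_over_inv_sq (A0 t : ℝ) (ht : t ≠ 0) : A0 / (2 * (1 / t ^ 2)) = A0 * t ^ 2 / 2 := by
  field_simp

/-- (29.5) in elementary form: `0 ≤ A₀`, `δ/2 ≤ t = tan(δ/2)`, `A₀t²/2 ≤ B₀` ⇒ `A₀δ²/8 ≤ B₀`. -/
theorem sink_lower_alg (A0 B0 δ t : ℝ) (hA : 0 ≤ A0) (hδ : 0 < δ) (ht : δ / 2 ≤ t)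
    (h : A0 * t ^ 2 / 2 ≤ B0) : A0 * δ ^ 2 / 8 ≤ B0 := by
  have h1 : (δ / 2) ^ 2 ≤ t ^ 2 := pow_le_pow_left₀ (by linarith) ht 2
  have h2 : A0 * (δ / 2) ^ 2 / 2 ≤ A0 * t ^ 2 / 2 := by
    apply div_le_div_of_nonneg_right _ (by norm_num)
    exact mul_le_mul_of_nonneg_left h1 hA
  have h3 : A0 * δ ^ 2 / 8 = A0 * (δ / 2) ^ 2 / 2 := by ring
  linarith

/-- (29.6): `πB₀ ≤ T + m₁/(2σ²)`, `T ≤ πB₀/2`, `0 < σ`, `η/π ≤ σ`, `0 ≤ η`, `0 ≤ B₀` ⇒ `B₀η²/π ≤ m₁`. -/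
theorem moment_lower_alg (B0 m1 T σ η : ℝ) (hB : 0 ≤ B0) (h : Real.pi * B0 ≤ T + m1 / (2 * σ ^ 2))
    (hT : T ≤ Real.pi * B0 / 2) (hσ0 : 0 < σ) (hσ : η / Real.pi ≤ σ) (hη : 0 ≤ η) :
    B0 * η ^ 2 / Real.pi ≤ m1 := by
  have hπ := Real.pi_pos
  have h1 : Real.pi * B0 / 2 ≤ m1 / (2 * σ ^ 2) := by linarith
  have h2 : Real.pi * B0 * σ ^ 2 ≤ m1 := by
    rw [le_div_iff₀ (by positivity)] at h1
    nlinarith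
  have h3 : (η / Real.pi) ^ 2 ≤ σ ^ 2 := pow_le_pow_left₀ (by positivity) hσ 2
  have h4 : B0 * η ^ 2 / Real.pi = Real.pi * B0 * (η / Real.pi) ^ 2 := by
    field_simp
  rw [h4]
  calc Real.pi * B0 * (η / Real.pi) ^ 2 ≤ Real.pi * B0 * σ ^ 2 := by
        apply mul_le_mul_of_nonneg_left h3; positivity
    _ ≤ m1 := h2

/-- Jordan for the half-angle: `0 ≤ η ≤ π/2` ⇒ `η/π ≤ sin(η/2)`. -/
theorem sin_half_ge (η : ℝ) (h0 : 0 ≤ η) (h1 : η ≤ Real.pi / 2) : η / Real.pi ≤ Real.sin (η / 2) := by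
  have h2 : η / 2 ≤ Real.pi / 2 := by linarith
  have h3 := Real.mul_le_sin (by linarith : 0 ≤ η / 2) h2
  have h4 : 2 / Real.pi * (η / 2) = η / Real.pi := by field_simp
  linarith [h4 ▸ h3]

/-! ### The algebra of COROLLARY 29.7 (iii)–(iv) -/

/-- On the window `3/5 < a < 1`: `1 + 1/B₀ < p < (5/3)(1 + 1/B₀)` for `p = (1 + 1/B₀)/a`, `B₀ > 0`; hence
`sup p = ∞ ⟺ inf B₀ = 0` along any family. -/
theorem p_bounds_of_window (a B0 p : ℝ) (ha1 : 3 / 5 < a) (ha2 : a < 1) (hB : 0 < B0)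
    (hp : p = (1 + 1 / B0) / a) : 1 + 1 / B0 < p ∧ p < 5 / 3 * (1 + 1 / B0) := by
  have hQ : 0 < 1 + 1 / B0 := by positivity
  have ha0 : 0 < a := by linarith
  subst hp
  constructor
  · rw [lt_div_iff₀ ha0]; nlinarith
  · rw [div_lt_iff₀ ha0]; nlinarith

/-- COROLLARY 29.7 (iv): `p = (1 + 1/B₀)/a ≤ p♯`, `0 < a < 1`, `B₀ > 0` ⇒ `p♯a > 1` and `B₀ ≥ 1/(p♯a − 1)`. -/
theorem sink_strain_lower_of_p_le (a B0 p psharp : ℝ) (ha0 : 0 < a) (hB : 0 < B0)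
    (hp : p = (1 + 1 / B0) / a) (hle : p ≤ psharp) : 1 < psharp * a ∧ 1 / (psharp * a - 1) ≤ B0 := by
  have hpa : p * a = 1 + 1 / B0 := by rw [hp]; field_simp
  have h1 : 0 < 1 / B0 := by positivity
  have h2 : p * a ≤ psharp * a := mul_le_mul_of_nonneg_right hle ha0.le
  refine ⟨by linarith, ?_⟩
  calc 1 / (psharp * a - 1) ≤ 1 / (p * a - 1) :=
        one_div_le_one_div_of_le (by linarith) (by linarith)
    _ = B0 := by rw [hpa]; field_simp; ring

/-- The quantisation at a rung, in the form used by the typed statements: `p = (1 − 1/H)/a = P` with `H < 0`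
⇒ `H = −1/(Pa − 1)` (`H = Hf(π)`). -/
theorem strain_of_rung (a H P : ℝ) (hH : H < 0) (ha : a ≠ 0) (hp : (1 - 1 / H) / a = P) :
    H = -(1 / (a * P - 1)) := by
  have h1 : 1 - 1 / H = P * a := by
    field_simp at hp; linarith
  have hH0 : H ≠ 0 := ne_of_lt hH
  have h2 : 1 / H = 1 - P * a := by linarith
  have h3 : a * P - 1 ≠ 0 := by
    intro h0
    have : 1 / H = 0 := by rw [h2]; linarith
    rw [one_div, inv_eq_zero] at this
    exact hH0 this
  have h4 : H = 1 / (1 - P * a) := by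
    rw [← h2, one_div_one_div]
  have h5 : (1 : ℝ) - P * a = -(a * P - 1) := by ring
  rw [h4, h5, one_div_neg_eq_neg_one_div]

end Summit.NavierStokesRegularity.OSWSelfSimilar.Mechanism.GlobalBranch
end
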